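import Summits.RiemannHypothesis.RiemannHypothesis.Theorems.Splittings.LinearRayFiniteReachLaplace
import Literature.NumberTheory.LFunctions.XiMoments
import HarnessLib

/-!
# Every fixed-point Laguerre certificate against the linear-factor ray has FINITE REACH in `a` — part 2: `H_0`

Cell rh-split (D-0116 arm), ENGINE 5 (rh-splitx-eng-5 g4), object (ii) of lead RULING #212 (candidate barrier
sentence for the pointwise-certificate method of class (xviii), dbn linear ray).  The kernel refutations of the
linear-factor ray `HasOnlyRealZeros (linearFactorH a)` (`Literature/Barriers/RiemannHypothesis/NewmanConjecture.lean`)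
in `Theorems/Splittings/LinearRayOnePoint*.lean` / `LinearRayTwoPoint.lean` / `LinearRayLehmerWindow*.lean` all rest
on a Laguerre certificate at ONE or TWO fixed real points of `H_0 = deBruijnH 0`, built from the forward average
`Q_a(s) = ∫₀^∞ H_0(s+y) e^{−ay} dy`:
* one-point (`LinearRayOnePoint.not_linearRay_of_onePoint`): `H_0(s)² < Q_a(s)·(a H_0(s) − H_0′(s))`;
* two-point (`LinearRayTwoPoint.not_linearRay_of_signChange`): `Q_a > 0` on `[x, x′]` with `H_0(x) > 0 > H_0(x′)`.
This file proves, RH-free and for ARBITRARY data, that both shapes fail for all sufficiently large `a`: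
`a·Q_a(s) = H_0(s) + Q_a[H_0′](s)` (integration by parts), whence `Q_a(s) = H_0(s)/a + H_0′(s)/a² + O(a⁻³)` and
`Q_a(s)(aH_0(s) − H_0′(s)) − H_0(s)² = H_0·Q_a[H_0′] − H_0′·Q_a[H_0] = (H_0H_0″ − H_0′²)(s)/a² + O(a⁻³)`.
So (1) wherever the strict Laguerre inequality `H_0′(s)² > H_0(s)H_0″(s)` holds — in particular at every SIMPLE
real zero of `H_0` — the one-point certificate is false for `a ≥ a₀(s)` (`onePoint_certificate_finite_reach`,
`…_at_simple_zero`); (2) at every `x′` with `H_0(x′) < 0` the forward average `Q_a(x′)` is negative for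
`a ≥ a₀(x′)`, so the two-point certificate's positivity hypothesis fails at its own right endpoint
(`twoPoint_certificate_finite_reach`).  The abstract statements (`laplaceFwd_*`, any `C³` function with bounded
derivatives) come first; the constants are explicit (`a₀ = 2M²/δ`, `a₀ = M/|H_0(x′)|` with
`M = 6∫₀^∞ |Φ(u)|e^{u} du ≥ sup|H_0^{(k)}|`, `k ≤ 3`).
BARRIER SENTENCE (candidate, for the referee): «every fixed-pair / fixed-point Laguerre certificate against the
linear ray has finite reach a_max(point) — each further range of a needs new points (closer pairs of zeros higher
up); the method cannot give the a-uniform statement.»  Nothing here uses or bears on RH.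
HONEST LABEL: RH-free by-product about a refutation METHOD for an RH-STRENGTHENING conjunct; not a splitting;
nothing here bears on the truth of RH.
-/

set_option linter.dupNamespace false

noncomputable section

namespace Summit.RiemannHypothesis.RiemannHypothesis.Theorems.Splittings.LinearRayFiniteReach

open Set MeasureTheory Filter Topology
open Literature.NumberTheory.LFunctions

/-! ## The derivatives of `H_0` on the real axis and their bounds -/

/-- The real `k`-th derivative datum of `H_0` on `ℝ`: `x ↦ Re H_0^{(k)}(x)` has derivative `Re H_0^{(k+1)}`.
[folklore] -/
theorem hasDerivAt_re_deBruijnH0Deriv (k : ℕ) (x : ℝ) :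
    HasDerivAt (fun x : ℝ => (deBruijnH0Deriv k (x : ℂ)).re) ((deBruijnH0Deriv (k + 1) (x : ℂ)).re) x := by
  have h1 : HasDerivAt (fun x : ℝ => deBruijnH0Deriv k (x : ℂ)) (deBruijnH0Deriv (k + 1) (x : ℂ)) x :=
    (hasDerivAt_deBruijnH0Deriv k (x : ℂ)).comp_ofReal
  have h2 := (Complex.reCLM.hasFDerivAt).comp_hasDerivAt x h1
  simpa [Function.comp_def] using h2

/-- `x ↦ Re H_0^{(k)}(x)` is continuous on `ℝ`. [folklore] -/
theorem continuous_re_deBruijnH0Deriv (k : ℕ) : Continuous fun x : ℝ => (deBruijnH0Deriv k (x : ℂ)).re :=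
  continuous_iff_continuousAt.2 fun x => (hasDerivAt_re_deBruijnH0Deriv k x).continuousAt

/-- **Uniform bound on the real axis**: `|Re H_0^{(k)}(x)| ≤ k! · ∫₀^∞ |Φ(u)| e^{u} du`. [folklore] -/
theorem abs_re_deBruijnH0Deriv_le (k : ℕ) (x : ℝ) :
    |(deBruijnH0Deriv k (x : ℂ)).re| ≤ (k.factorial : ℝ) * ∫ u in Ioi (0:ℝ), deBruijnHBound 0 1 u := by
  refine (Complex.abs_re_le_norm _).trans ?_
  rw [deBruijnH0Deriv, ← integral_const_mul]
  refine norm_integral_le_of_norm_le ((integrableOn_deBruijnHBound 0 1).const_mul _)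
    ((ae_restrict_iff' measurableSet_Ioi).2 (Filter.Eventually.of_forall fun u hu => ?_))
  have h := norm_deBruijnH0DerivIntegrand_le (z := (x : ℂ)) (Y := 0) (by simp) (le_of_lt hu) k
  simpa using h

/-- The common bound `M_H := 6 ∫₀^∞ |Φ(u)| e^{u} du` dominates `|Re H_0^{(k)}|` for `k ≤ 3`. [folklore] -/
theorem abs_re_deBruijnH0Deriv_le_six {k : ℕ} (hk : k ≤ 3) (x : ℝ) :
    |(deBruijnH0Deriv k (x : ℂ)).re| ≤ 6 * ∫ u in Ioi (0:ℝ), deBruijnHBound 0 1 u := by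
  refine (abs_re_deBruijnH0Deriv_le k x).trans (mul_le_mul_of_nonneg_right ?_ ?_)
  · have : k.factorial ≤ 6 := by
      interval_cases k <;> decide
    exact_mod_cast this
  · exact setIntegral_nonneg measurableSet_Ioi fun u hu => by
      unfold deBruijnHBound; positivity

/-- `H_0` on `ℝ` in terms of the derivative data: `Re H_0(x) = Re H_0^{(0)}(x)`,
`Re H_0′(x) = Re H_0^{(1)}(x)`, `Re H_0″(x) = Re H_0^{(2)}(x)`. [folklore] -/
theorem re_deBruijnH_derivs (x : ℝ) :
    (deBruijnH 0 (x : ℂ)).re = (deBruijnH0Deriv 0 (x : ℂ)).re ∧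
    (deriv (deBruijnH 0) (x : ℂ)).re = (deBruijnH0Deriv 1 (x : ℂ)).re ∧
    (deriv (deriv (deBruijnH 0)) (x : ℂ)).re = (deBruijnH0Deriv 2 (x : ℂ)).re := by
  refine ⟨by rw [deBruijnH0Deriv_zero], ?_, ?_⟩
  · rw [← deBruijnH0Deriv_zero, deriv_deBruijnH0Deriv]
  · rw [← deBruijnH0Deriv_zero, deriv_deBruijnH0Deriv, deriv_deBruijnH0Deriv]

/-- The forward average of the tree's certificates is the real Laplace average of `x ↦ Re H_0(x)`:
`Re ∫₀^∞ H_0(s+y) e^{−ay} dy = ∫₀^∞ Re H_0(s+y) e^{−ay} dy` (`a > 0`). [folklore] -/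
theorem re_fwdAvg_eq (s : ℝ) {a : ℝ} (ha : 0 < a) :
    (∫ y in Ioi (0 : ℝ), deBruijnH 0 ((s : ℂ) + y) * (Real.exp (-(a * y)) : ℂ)).re =
      ∫ y in Ioi (0:ℝ), (deBruijnH0Deriv 0 ((s + y : ℝ) : ℂ)).re * Real.exp (-(a * y)) := by
  -- integrability of the complex integrand from the integrand bound `‖H_0(x)‖ ≤ 0!·∫|Φ|e^u`
  have hnorm : ∀ y : ℝ, ‖deBruijnH 0 ((s : ℂ) + y)‖ ≤ (Nat.factorial 0 : ℝ) * ∫ u in Ioi (0:ℝ), deBruijnHBound 0 1 u := by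
    intro y
    rw [← deBruijnH0Deriv_zero, show ((s : ℂ) + y) = ((s + y : ℝ) : ℂ) by push_cast; ring, deBruijnH0Deriv,
      ← integral_const_mul]
    refine norm_integral_le_of_norm_le ((integrableOn_deBruijnHBound 0 1).const_mul _)
      ((ae_restrict_iff' measurableSet_Ioi).2 (Filter.Eventually.of_forall fun u hu => ?_))
    have h := norm_deBruijnH0DerivIntegrand_le (z := ((s + y : ℝ) : ℂ)) (Y := 0) (by simp) (le_of_lt hu) 0
    simpa using h
  set B := (Nat.factorial 0 : ℝ) * ∫ u in Ioi (0:ℝ), deBruijnHBound 0 1 u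
  have hcont : Continuous fun y : ℝ => deBruijnH 0 ((s : ℂ) + y) * (Real.exp (-(a * y)) : ℂ) := by
    have h1 : Continuous fun y : ℝ => deBruijnH 0 ((s : ℂ) + y) := by
      have hc : Continuous (deBruijnH 0) := by
        rw [← deBruijnH0Deriv_zero]
        exact continuous_iff_continuousAt.2 fun z => (hasDerivAt_deBruijnH0Deriv 0 z).continuousAt
      exact hc.comp (by fun_prop)
    exact h1.mul (by fun_prop)
  have hint : Integrable (fun y : ℝ => deBruijnH 0 ((s : ℂ) + y) * (Real.exp (-(a * y)) : ℂ)) (volume.restrict (Ioi 0)) := by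
    refine Integrable.mono' ((integrableOn_exp_mul_Ioi (by linarith : -a < 0) 0).const_mul B)
      hcont.aestronglyMeasurable ((ae_restrict_iff' measurableSet_Ioi).2 (Filter.Eventually.of_forall fun y _ => ?_))
    rw [norm_mul, Complex.norm_real, Real.norm_of_nonneg (Real.exp_pos _).le, show -(a * y) = -a * y by ring]
    exact mul_le_mul_of_nonneg_right (hnorm y) (Real.exp_pos _).le
  have hcomm := Complex.reCLM.integral_comp_comm hint
  simp only [Complex.reCLM_apply] at hcomm
  rw [← hcomm]
  refine setIntegral_congr_fun measurableSet_Ioi fun y _ => ?_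
  rw [Complex.mul_re, Complex.ofReal_re, Complex.ofReal_im, mul_zero, sub_zero, deBruijnH0Deriv_zero,
    show ((s : ℂ) + y) = ((s + y : ℝ) : ℂ) by push_cast; ring]

/-! ## Finite reach for `H_0` -/

/-- **The one-point certificate has finite reach.** At every real `s` where `H_0′(s)² > H_0(s)H_0″(s)` (strict
Laguerre), the hypothesis of `LinearRayOnePoint.not_linearRay_of_onePoint` FAILS for every
`a > max 0 (2M_H²/(H_0′(s)² − H_0(s)H_0″(s)))`, `M_H = 6∫₀^∞|Φ(u)|e^{u}du`. [folklore] -/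
theorem onePoint_certificate_finite_reach {s : ℝ}
    (hLag : (deBruijnH 0 (s : ℂ)).re * (deriv (deriv (deBruijnH 0)) (s : ℂ)).re < (deriv (deBruijnH 0) (s : ℂ)).re ^ 2) :
    ∃ a₀ : ℝ, ∀ a : ℝ, a₀ < a →
      ¬ ((deBruijnH 0 (s : ℂ)).re ^ 2 <
          (∫ y in Ioi (0 : ℝ), deBruijnH 0 ((s : ℂ) + y) * (Real.exp (-(a * y)) : ℂ)).re *
            (a * (deBruijnH 0 (s : ℂ)).re - (deriv (deBruijnH 0) (s : ℂ)).re)) := by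
  obtain ⟨e0, e1, e2⟩ := re_deBruijnH_derivs s
  set M : ℝ := 6 * ∫ u in Ioi (0:ℝ), deBruijnHBound 0 1 u with hM
  set f0 : ℝ → ℝ := fun x => (deBruijnH0Deriv 0 (x : ℂ)).re
  set f1 : ℝ → ℝ := fun x => (deBruijnH0Deriv 1 (x : ℂ)).re
  set f2 : ℝ → ℝ := fun x => (deBruijnH0Deriv 2 (x : ℂ)).re
  set f3 : ℝ → ℝ := fun x => (deBruijnH0Deriv 3 (x : ℂ)).re
  have hLag' : f0 s * f2 s < f1 s ^ 2 := by simpa [f0, f1, f2, e0, e1, e2] using hLag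
  refine ⟨max 0 (2 * M ^ 2 / (f1 s ^ 2 - f0 s * f2 s)), fun a ha => ?_⟩
  have ha0 : 0 < a := lt_of_le_of_lt (le_max_left _ _) ha
  have ha' : 2 * M ^ 2 / (f1 s ^ 2 - f0 s * f2 s) < a := lt_of_le_of_lt (le_max_right _ _) ha
  have hneg := onePoint_expr_neg_of_large (f := f0) (f' := f1) (f'' := f2) (f''' := f3)
    (fun x => hasDerivAt_re_deBruijnH0Deriv 0 x) (fun x => hasDerivAt_re_deBruijnH0Deriv 1 x)
    (fun x => hasDerivAt_re_deBruijnH0Deriv 2 x) (continuous_re_deBruijnH0Deriv 3)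
    (fun x => abs_re_deBruijnH0Deriv_le_six (by norm_num) x) (fun x => abs_re_deBruijnH0Deriv_le_six (by norm_num) x)
    (fun x => abs_re_deBruijnH0Deriv_le_six (by norm_num) x) (fun x => abs_re_deBruijnH0Deriv_le_six (by norm_num) x)
    hLag' ha0 ha'
  rw [re_fwdAvg_eq s ha0, e0, e1]
  have e : (fun y : ℝ => (deBruijnH0Deriv 0 ((s + y : ℝ) : ℂ)).re * Real.exp (-(a * y))) =
      fun y : ℝ => f0 (s + y) * Real.exp (-(a * y)) := rfl
  rw [e]
  push Not
  linarith

/-- **At a simple real zero the one-point certificate has finite reach** (the Laguerre hypothesis is automatic: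
`H_0(s) = 0`, `H_0′(s) ≠ 0`). [folklore] -/
theorem onePoint_certificate_finite_reach_at_simple_zero {s : ℝ} (h0 : (deBruijnH 0 (s : ℂ)).re = 0)
    (h1 : (deriv (deBruijnH 0) (s : ℂ)).re ≠ 0) :
    ∃ a₀ : ℝ, ∀ a : ℝ, a₀ < a →
      ¬ ((deBruijnH 0 (s : ℂ)).re ^ 2 <
          (∫ y in Ioi (0 : ℝ), deBruijnH 0 ((s : ℂ) + y) * (Real.exp (-(a * y)) : ℂ)).re *
            (a * (deBruijnH 0 (s : ℂ)).re - (deriv (deBruijnH 0) (s : ℂ)).re)) :=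
  onePoint_certificate_finite_reach (by rw [h0, zero_mul]; positivity)

/-- **The two-point certificate has finite reach.** At every real `x′` with `H_0(x′) < 0` the forward average
`Q_a(x′)` is negative for every `a > max 0 (M_H/|H_0(x′)|)`; hence the positivity hypothesis
`∀ s ∈ [x, x′], 0 < Q_a(s)` of `LinearRayTwoPoint.not_linearRay_of_signChange` fails (at `s = x′`). [folklore] -/
theorem twoPoint_certificate_finite_reach {x' : ℝ} (hx' : (deBruijnH 0 (x' : ℂ)).re < 0) :
    ∃ a₀ : ℝ, ∀ a : ℝ, a₀ < a → ∀ x : ℝ, x ≤ x' →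
      ¬ (∀ s ∈ Icc x x', 0 < (∫ y in Ioi (0 : ℝ), deBruijnH 0 ((s : ℂ) + y) * (Real.exp (-(a * y)) : ℂ)).re) := by
  obtain ⟨e0, -, -⟩ := re_deBruijnH_derivs x'
  set M : ℝ := 6 * ∫ u in Ioi (0:ℝ), deBruijnHBound 0 1 u with hM
  set f0 : ℝ → ℝ := fun x => (deBruijnH0Deriv 0 (x : ℂ)).re
  set f1 : ℝ → ℝ := fun x => (deBruijnH0Deriv 1 (x : ℂ)).re
  have hs : f0 x' < 0 := by simpa [f0, e0] using hx'
  refine ⟨max 0 (M / |f0 x'|), fun a ha x hxx' hall => ?_⟩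
  have ha0 : 0 < a := lt_of_le_of_lt (le_max_left _ _) ha
  have ha' : M / |f0 x'| < a := lt_of_le_of_lt (le_max_right _ _) ha
  have hneg := laplaceFwd_neg_of_large (f := f0) (f' := f1) (fun x => hasDerivAt_re_deBruijnH0Deriv 0 x)
    (continuous_re_deBruijnH0Deriv 1) (fun x => abs_re_deBruijnH0Deriv_le_six (by norm_num) x)
    (fun x => abs_re_deBruijnH0Deriv_le_six (by norm_num) x) hs ha0 ha'
  have hpos := hall x' ⟨hxx', le_rfl⟩
  rw [re_fwdAvg_eq x' ha0] at hpos
  have e : (fun y : ℝ => (deBruijnH0Deriv 0 ((x' + y : ℝ) : ℂ)).re * Real.exp (-(a * y))) =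
      fun y : ℝ => f0 (x' + y) * Real.exp (-(a * y)) := rfl
  rw [e] at hpos
  linarith

/-- Mirror form (`LinearRayTwoPoint.not_linearRay_of_signChange'`): at every `x′` with `H_0(x′) > 0` the forward
average `Q_a(x′)` is positive for `a > a₀(x′)`, so the negativity hypothesis `∀ s ∈ [x, x′], Q_a(s) < 0` fails at
`s = x′`. [folklore] -/
theorem twoPoint_certificate_finite_reach' {x' : ℝ} (hx' : 0 < (deBruijnH 0 (x' : ℂ)).re) :
    ∃ a₀ : ℝ, ∀ a : ℝ, a₀ < a → ∀ x : ℝ, x ≤ x' →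
      ¬ (∀ s ∈ Icc x x', (∫ y in Ioi (0 : ℝ), deBruijnH 0 ((s : ℂ) + y) * (Real.exp (-(a * y)) : ℂ)).re < 0) := by
  obtain ⟨e0, -, -⟩ := re_deBruijnH_derivs x'
  set M : ℝ := 6 * ∫ u in Ioi (0:ℝ), deBruijnHBound 0 1 u with hM
  set f0 : ℝ → ℝ := fun x => (deBruijnH0Deriv 0 (x : ℂ)).re
  set f1 : ℝ → ℝ := fun x => (deBruijnH0Deriv 1 (x : ℂ)).re
  have hs : 0 < f0 x' := by simpa [f0, e0] using hx'
  refine ⟨max 0 (M / |f0 x'|), fun a ha x hxx' hall => ?_⟩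
  have ha0 : 0 < a := lt_of_le_of_lt (le_max_left _ _) ha
  have ha' : M / |f0 x'| < a := lt_of_le_of_lt (le_max_right _ _) ha
  have hpos' := laplaceFwd_pos_of_large (f := f0) (f' := f1) (fun x => hasDerivAt_re_deBruijnH0Deriv 0 x)
    (continuous_re_deBruijnH0Deriv 1) (fun x => abs_re_deBruijnH0Deriv_le_six (by norm_num) x)
    (fun x => abs_re_deBruijnH0Deriv_le_six (by norm_num) x) hs ha0 ha'
  have hneg := hall x' ⟨hxx', le_rfl⟩
  rw [re_fwdAvg_eq x' ha0] at hneg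
  have e : (fun y : ℝ => (deBruijnH0Deriv 0 ((x' + y : ℝ) : ℂ)).re * Real.exp (-(a * y))) =
      fun y : ℝ => f0 (x' + y) * Real.exp (-(a * y)) := rfl
  rw [e] at hneg
  linarith

/-- **Limit form**: for every real `s`, `a · Re Q_a(s) → Re H_0(s)` as `a → ∞` — the forward average forgets
everything but the value at the point, which is why no fixed point can serve all `a`. [folklore] -/
theorem tendsto_mul_fwdAvg (s : ℝ) :
    Tendsto (fun a : ℝ => a * (∫ y in Ioi (0 : ℝ), deBruijnH 0 ((s : ℂ) + y) * (Real.exp (-(a * y)) : ℂ)).re)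
      atTop (𝓝 (deBruijnH 0 (s : ℂ)).re) := by
  obtain ⟨e0, -, -⟩ := re_deBruijnH_derivs s
  set M : ℝ := 6 * ∫ u in Ioi (0:ℝ), deBruijnHBound 0 1 u with hM
  set f0 : ℝ → ℝ := fun x => (deBruijnH0Deriv 0 (x : ℂ)).re
  set f1 : ℝ → ℝ := fun x => (deBruijnH0Deriv 1 (x : ℂ)).re
  have hM0 : ∀ x, |f0 x| ≤ M := fun x => abs_re_deBruijnH0Deriv_le_six (by norm_num) x
  have hM1 : ∀ x, |f1 x| ≤ M := fun x => abs_re_deBruijnH0Deriv_le_six (by norm_num) x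
  -- for a > 0: |a·L − f0 s| ≤ M/a
  have hkey : ∀ a : ℝ, 0 < a →
      |a * (∫ y in Ioi (0 : ℝ), deBruijnH 0 ((s : ℂ) + y) * (Real.exp (-(a * y)) : ℂ)).re - (deBruijnH 0 (s : ℂ)).re| ≤ M / a := by
    intro a ha
    rw [re_fwdAvg_eq s ha, e0]
    have hibp := laplaceFwd_ibp (g := f0) (g' := f1) (fun x => hasDerivAt_re_deBruijnH0Deriv 0 x)
      (continuous_re_deBruijnH0Deriv 1) hM0 hM1 ha s
    obtain ⟨-, hb⟩ := laplaceFwd_bound (continuous_re_deBruijnH0Deriv 1) hM1 ha s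
    have e : (fun y : ℝ => (deBruijnH0Deriv 0 ((s + y : ℝ) : ℂ)).re * Real.exp (-(a * y))) =
        fun y : ℝ => f0 (s + y) * Real.exp (-(a * y)) := rfl
    have e2 : f0 s = (deBruijnH0Deriv 0 (s : ℂ)).re := rfl
    have hb' : |∫ y in Ioi (0:ℝ), f1 (s + y) * Real.exp (-(a * y))| ≤ M / a := hb
    rw [e, hibp, ← e2, add_sub_cancel_left]
    exact hb'
  rw [Metric.tendsto_atTop]
  intro ε hε
  have hMnn : 0 ≤ M := (abs_nonneg _).trans (hM0 0)
  refine ⟨max 1 (2 * M / ε), fun a ha => ?_⟩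
  have ha1 : 1 ≤ a := (le_max_left _ _).trans ha
  have ha0 : 0 < a := by linarith
  have hMa : M / a < ε := by
    rw [div_lt_iff₀ ha0]
    have := (le_max_right _ _).trans ha
    rw [div_le_iff₀ hε] at this
    nlinarith
  rw [Real.dist_eq]
  exact (hkey a ha0).trans_lt hMa

end Summit.RiemannHypothesis.RiemannHypothesis.Theorems.Splittings.LinearRayFiniteReach

end
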